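import Summits.Ventures.QEC.Census.AdditiveCertBZ
import HarnessLib

/-!
# `AddCert` certificates, VI: bridge lemmas for the Brouwer–Zimmermann branch on the 3n-bit image (theorems only)

Sequel of `Census/AdditiveCertBZ.lean` (qec-type-02 gen 4; data `AddBZData`, checks `checkBZ` / `bzEnum`); the conclusions
(`isAdditiveCode_of_bz`, `minDistance_code_of_bz`, `isPure_of_bz`, assembly helpers, `[[5,1,3]]` control) are in
`Census/AdditiveCertBZSound.lean`. Here, check by check:
* the image `τ : Ē → 𝔽₂^{3n}`, `(x | z) ↦ (x | z | x + z)`: evaluation (`tauLin_apply`), injectivity (`tauLin_injective`), WEIGHT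
  DOUBLING `wt (τ w) = 2·swt w` (`hammingNorm_tauLin`), and the packed form `τ (ofBitPair x z) = ofBits (3n) (tau3 (x, z))`
  (`tauLin_ofBitPair`); every vector of `Ē` is a packed pair (`exists_ofBitPair_eq`);
* a symplectic rank table makes a word list linearly independent (`linearIndependent_of_sympTable`, the generic form of
  type-02's `AddCert.linearIndependent_rowVec`), hence `gensOK` ⇒ `span gens = S̄⊥` by `dim S̄⊥ = 2n − |rows|`
  (`span_gens_eq_sympDual`), and each generator's image is a row of the block matrix `G_b` (`tauLin_gen_mem_span`);
* the replay: `matrixSysOK` + `matrixEnumOK` ⇒ every selection of `1 … t_i` rows of `G_i` whose codeword has weight `≤ wmax` gives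
  an ALLOW-LISTED codeword (`exists_allow_of_matrixEnumOK` — qec-type-10's `henum_of_matrixOK` with the sharper conclusion the
  additive branch needs, same proof through `Census/CertBZWords.lean`).
Standard axioms; no definitions. [cite: Grassl2006, §2.1 Algorithm 2.5] for the method; [folklore] for `τ`.
-/

set_option autoImplicit false

namespace Summit.Ventures.QEC.Census

open Matrix Finset Literature.InformationTheory.QuantumCodes Literature.InformationTheory.Coding

/-! ## `τ`: evaluation, injectivity, weight doubling, packed form -/

section Tau

variable {n : ℕ}

/-- Evaluation of `τ` at coordinate `j + n·a`. -/
theorem tauLin_apply (w : SympVec n) (p : Fin 3 × Fin n) : tauLin n w (finProdFinEquiv p) = tauBlock w p := by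
  show tauBlock w (finProdFinEquiv.symm (finProdFinEquiv p)) = tauBlock w p
  rw [Equiv.symm_apply_apply]

/-- Block `0` is the `x`-part. -/
theorem tauBlock_zero (w : SympVec n) (j : Fin n) : tauBlock w (0, j) = w.1 j := by
  simp [tauBlock]

/-- Block `1` is the `z`-part. -/
theorem tauBlock_one (w : SympVec n) (j : Fin n) : tauBlock w (1, j) = w.2 j := by
  simp [tauBlock]

/-- Block `2` is `x + z`. -/
theorem tauBlock_two (w : SympVec n) (j : Fin n) : tauBlock w (2, j) = w.1 j + w.2 j := by
  simp [tauBlock]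

/-- **`τ` is injective** (the first two blocks are the two halves of `w`). -/
theorem tauLin_injective (n : ℕ) : Function.Injective (tauLin n) := by
  intro v w h
  have key : ∀ p : Fin 3 × Fin n, tauBlock v p = tauBlock w p := fun p => by
    have := congrFun h (finProdFinEquiv p)
    rwa [tauLin_apply, tauLin_apply] at this
  refine Prod.ext (funext fun j => ?_) (funext fun j => ?_)
  · simpa only [tauBlock_zero] using key (0, j)
  · simpa only [tauBlock_one] using key (1, j)

/-- Per position, the three image bits `x_j, z_j, x_j + z_j` contain exactly `2·[x_j ≠ 0 ∨ z_j ≠ 0]` ones. -/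
private theorem tau_count (a b : ZMod 2) :
    ((if a ≠ 0 then 1 else 0) + (if b ≠ 0 then 1 else 0) + (if a + b ≠ 0 then 1 else 0) : ℕ) =
      2 * (if (a ≠ 0 ∨ b ≠ 0) then 1 else 0) := by
  revert a b; decide

/-- **Weight doubling**: `wt (τ w) = 2 · swt w`. [folklore] -/
theorem hammingNorm_tauLin (n : ℕ) (w : SympVec n) : hammingNorm (tauLin n w) = 2 * sympWeight w := by
  classical
  have h1 : hammingNorm (tauLin n w) = (univ.filter fun p : Fin 3 × Fin n => tauBlock w p ≠ 0).card := by
    rw [hammingNorm, ← Finset.map_univ_equiv (finProdFinEquiv (m := 3) (n := n)), Finset.filter_map,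
      Finset.card_map]
    congr 1
    refine Finset.filter_congr fun p _ => ?_
    simp only [Function.comp_apply, Equiv.coe_toEmbedding, tauLin_apply]
  rw [h1, sympWeight, Finset.card_filter, Finset.card_filter, Fintype.sum_prod_type_right, Finset.mul_sum]
  refine Finset.sum_congr rfl fun j _ => ?_
  rw [Fin.sum_univ_three, tauBlock_zero, tauBlock_one, tauBlock_two]
  exact tau_count (w.1 j) (w.2 j)

/-- `τ w ≠ 0` for `w ≠ 0`. -/
theorem tauLin_ne_zero {w : SympVec n} (hw : w ≠ 0) : tauLin n w ≠ 0 := by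
  intro h
  apply hw
  apply tauLin_injective n
  rw [h, map_zero]

/-- In `𝔽₂`: `[a] + [b] = [a xor b]` for bits read as `0/1`. -/
private theorem ite_add_ite_eq_ite_xor (a b : Bool) :
    ((if a = true then 1 else 0) + (if b = true then 1 else 0) : ZMod 2) = if (a ^^ b) = true then 1 else 0 := by
  cases a <;> cases b <;> decide

/-- **Packed form**: on a packed pair below `2^n` the image is the `3n`-bit word `tau3`. -/
theorem tauLin_ofBitPair (n x z : ℕ) (hx : x < 2 ^ n) (hz : z < 2 ^ n) :
    tauLin n (ofBitPair n x z) = ofBits (3 * n) (tau3 n (x, z)) := by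
  funext i
  obtain ⟨⟨a, j⟩, rfl⟩ := finProdFinEquiv.surjective i
  rw [tauLin_apply]
  have hxj : ∀ m, n ≤ m → x.testBit m = false := fun m hm =>
    Nat.testBit_lt_two_pow (lt_of_lt_of_le hx (Nat.pow_le_pow_right (by norm_num) hm))
  have hzj : ∀ m, n ≤ m → z.testBit m = false := fun m hm =>
    Nat.testBit_lt_two_pow (lt_of_lt_of_le hz (Nat.pow_le_pow_right (by norm_num) hm))
  have hj := j.2
  simp only [ofBits, finProdFinEquiv_apply_val, tau3, Nat.testBit_lor, Nat.testBit_shiftLeft, Nat.testBit_xor]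
  fin_cases a
  · -- block 0: coordinate `j`
    simp only [tauBlock, Fin.zero_eta, Fin.isValue, ↓reduceIte, ofBitPair_fst, mul_zero, add_zero,
      Summit.Ventures.QEC.ofBits_apply]
    have k1 : ¬ n ≤ j.1 := by omega
    have k2 : ¬ 2 * n ≤ j.1 := by omega
    simp [k1, k2]
  · -- block 1: coordinate `j + n`
    simp only [tauBlock, Fin.mk_one, Fin.isValue, one_ne_zero, ↓reduceIte, ofBitPair_snd, mul_one,
      Summit.Ventures.QEC.ofBits_apply]
    have k1 : n ≤ j.1 + n := by omega
    have k2 : ¬ 2 * n ≤ j.1 + n := by omega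
    simp [k1, k2, hxj (j.1 + n) (by omega)]
  · -- block 2: coordinate `j + 2n`
    simp only [tauBlock, Fin.reduceFinMk, Fin.isValue, Fin.reduceEq, ↓reduceIte, ofBitPair_fst, ofBitPair_snd,
      Summit.Ventures.QEC.ofBits_apply]
    have k1 : n ≤ j.1 + n * 2 := by omega
    have k2 : 2 * n ≤ j.1 + n * 2 := by omega
    have e1 : j.1 + n * 2 - n = j.1 + n := by omega
    have e2 : j.1 + n * 2 - 2 * n = j.1 := by omega
    simp [k1, k2, hxj (j.1 + n * 2) (by omega), hzj (j.1 + n) (by omega), e1, e2, ite_add_ite_eq_ite_xor]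

/-- Every vector of `Ē` is a packed pair below `2^n`. -/
theorem exists_ofBitPair_eq (n : ℕ) (w : SympVec n) : ∃ x < 2 ^ n, ∃ z < 2 ^ n, ofBitPair n x z = w := by
  obtain ⟨x, hx, hxe⟩ := Summit.Ventures.QEC.exists_ofBits_eq w.1
  obtain ⟨z, hz, hze⟩ := Summit.Ventures.QEC.exists_ofBits_eq w.2
  exact ⟨x, hx, z, hz, Prod.ext hxe hze⟩

end Tau

/-! ## Rank tables and the span of the normaliser generators -/

/-- `l.getD i d = l[i]` for an index in range. -/
private theorem getD_eq_getElem' {α : Type*} {l : List α} {i : ℕ} {dflt : α} (h : i < l.length) :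
    l.getD i dflt = l[i] := by
  rw [List.getD_eq_getElem?_getD, List.getElem?_eq_getElem h, Option.getD_some]

/-- **Rank table ⇒ independence** (as `AddCert.linearIndependent_rowVec`, for any word list with partners):
`⟨G[a], Gi[i]⟩ ≡ [a = i]` makes the vectors of `G` linearly independent. -/
theorem linearIndependent_of_sympTable (n : ℕ) (G Gi : List (ℕ × ℕ))
    (htab : ∀ a < G.length, ∀ i < G.length,
      sympParity n (G.getD a (0, 0)) (Gi.getD i (0, 0)) = if a = i then 1 else 0) :
    LinearIndependent (ZMod 2) (fun i : Fin G.length => ofBitPair n (G[i]).1 (G[i]).2) := by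
  rw [Fintype.linearIndependent_iff]
  intro g hg i
  let u : SympVec n := ofBitPair n (Gi.getD i (0, 0)).1 (Gi.getD i (0, 0)).2
  have h0 : sympForm n (∑ a, g a • ofBitPair n (G[a]).1 (G[a]).2) u = 0 := by
    rw [hg, map_zero, LinearMap.zero_apply]
  rw [map_sum, LinearMap.sum_apply] at h0
  simp only [map_smul, LinearMap.smul_apply, sympForm_apply, smul_eq_mul] at h0
  have htab' : ∀ a : Fin G.length, sympInner (ofBitPair n (G[a]).1 (G[a]).2) u = if a = i then 1 else 0 :=
    fun a => by
      have hra : ofBitPair n (G[a]).1 (G[a]).2 = ofBitPair n (G.getD a (0, 0)).1 (G.getD a (0, 0)).2 := by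
        rw [getD_eq_getElem' a.2, Fin.getElem_fin]
      rw [hra, sympInner_ofBitPair_eq_sympParity, htab a a.2 i i.2]
      by_cases hai : a = i
      · simp [hai]
      · simp [hai, Fin.val_eq_val]
  simp only [htab', mul_ite, mul_one, mul_zero, Finset.sum_ite_eq', Finset.mem_univ, if_true] at h0
  exact h0

namespace AddCert

variable (c : AddCert) (z : AddBZData)

/-- **`gensOK` ⇒ the generators span the normaliser**: `span {gens} = S̄⊥` (containment by the zero syndromes,
equality by `dim S̄⊥ = 2n − |rows| = |gens|` and independence from the rank table). -/
theorem span_gens_eq_sympDual (hind : c.indepOK = true) (hg : c.gensOK z = true) :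
    Submodule.span (ZMod 2) (Set.range fun i : Fin z.gens.length => ofBitPair c.n (z.gens[i]).1 (z.gens[i]).2) =
      sympDual c.code := by
  simp only [gensOK, Bool.and_eq_true, beq_iff_eq, List.all_eq_true, List.mem_range, decide_eq_true_eq] at hg
  obtain ⟨⟨⟨hcount, -⟩, hall⟩, htab⟩ := hg
  apply Submodule.eq_of_le_of_finrank_le
  · rw [Submodule.span_le]
    rintro _ ⟨i, rfl⟩
    exact (c.mem_sympDual_code_iff (z.gens[i])).2 (hall _ (List.getElem_mem i.2)).1.1
  · have hli := linearIndependent_of_sympTable c.n z.gens z.ginv htab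
    rw [finrank_span_eq_card hli, Fintype.card_fin]
    have h1 := finrank_sympDual_add c.code
    rw [c.finrank_code hind] at h1
    omega

/-- The image of a normaliser generator is the corresponding row of the block matrix `G_b`. -/
theorem tauLin_gen_mem_span (hg : c.gensOK z = true) (i : Fin z.gens.length) :
    tauLin c.n (ofBitPair c.n (z.gens[i]).1 (z.gens[i]).2) ∈
      Submodule.span (ZMod 2) (Set.range fun j : Fin (c.gb3 z).length => rowMatrix (3 * c.n) (c.gb3 z) j) := by
  simp only [gensOK, Bool.and_eq_true, beq_iff_eq, List.all_eq_true, decide_eq_true_eq] at hg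
  obtain ⟨⟨-, hall⟩, -⟩ := hg
  obtain ⟨⟨-, hx⟩, hz⟩ := hall _ (List.getElem_mem i.2)
  simp only [Fin.getElem_fin]
  rw [tauLin_ofBitPair _ _ _ hx hz]
  have hi : (i : ℕ) < (c.gb3 z).length := by rw [gb3, List.length_map]; exact i.2
  refine Submodule.subset_span ⟨⟨i, hi⟩, ?_⟩
  funext q
  simp only [rowMatrix, Fin.getElem_fin, gb3, List.getElem_map]

/-! ## The enumeration verdict of one matrix -/

/-- **C4 ⇒ the enumeration property** (variant of type-10's `henum_of_matrixOK` with the sharper conclusion the additive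
branch needs): if matrix `G_i` is systematic with rows below `2^N` and its replay verdict holds, then every selection `a`
with `1 ≤ |a| ≤ t_i` whose codeword has weight `≤ wmax` gives an ALLOW-LISTED codeword. -/
theorem exists_allow_of_matrixEnumOK {N wmax : ℕ} {allow Gb : List ℕ} {mt : BZMatrix}
    (hsys : matrixSysOK N Gb mt = true) (henum : matrixEnumOK wmax allow Gb mt = true)
    {kb : ℕ} (hk : (giRows Gb mt).length = kb) (a : Fin kb → ZMod 2) (ha1 : 1 ≤ hammingNorm a)
    (hat : hammingNorm a ≤ mt.t) (haw : hammingNorm (∑ j, a j • rowFun N (giRows Gb mt) kb j) ≤ wmax) :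
    ∃ e ∈ allow, ofBits N e = ∑ j, a j • rowFun N (giRows Gb mt) kb j := by
  subst hk
  simp only [matrixSysOK, Bool.and_eq_true, List.all_eq_true, decide_eq_true_eq] at hsys
  obtain ⟨-, hlt⟩ := hsys
  rw [matrixEnumOK] at henum
  have hreach := reaches_of_scan henum (rowSupp (giRows Gb mt) a) (rowSupp_sublist _ a)
    (by rw [length_rowSupp]; exact hat)
  rw [Nat.zero_xor, Nat.zero_xor, bzLeaf] at hreach
  have hsum : ∑ j, a j • rowFun N (giRows Gb mt) (giRows Gb mt).length j =
      ofBits N (xorSnd (rowSupp (giRows Gb mt) a)) := by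
    rw [ofBits_xorSnd_rowSupp, ← sum_smul_rowMatrix_eq_vecMul]
    refine Finset.sum_congr rfl fun j _ => ?_
    congr 1
    funext q
    simp only [rowFun, rowMatrix, Fin.getElem_fin, List.getD_eq_getElem?_getD, List.getElem?_eq_getElem j.2,
      Option.getD_some]
  have hu : xorFst (rowSupp (giRows Gb mt) a) ≠ 0 := by
    intro h0
    have ha := ofBits_xorFst_rowSupp (giRows Gb mt) a
    rw [h0, ofBits_zero] at ha
    have hpos : 0 < hammingNorm a := ha1
    rw [hammingNorm_pos_iff] at hpos
    exact hpos ha.symm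
  have hclt : xorSnd (rowSupp (giRows Gb mt) a) < 2 ^ N := by
    refine xorList_lt N _ fun x hx => ?_
    simp only [rowSupp, List.map_map, List.mem_map, Function.comp_apply] at hx
    obtain ⟨j, hj, rfl⟩ := hx
    have hjl := lt_of_mem_suppIdx _ a hj
    rw [List.getD_eq_getElem?_getD, List.getElem?_eq_getElem hjl, Option.getD_some]
    exact hlt _ (List.getElem_mem hjl)
  simp only [Bool.or_eq_true, beq_iff_eq] at hreach
  rcases hreach with (h0 | hwt) | hmem
  · exact absurd h0 hu
  · have h1 := lt_popc_of_wtGt N wmax _ hclt hwt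
    rw [← hammingNorm_ofBits, ← hsum] at h1
    omega
  · exact ⟨_, List.mem_of_elem_eq_true hmem, hsum.symm⟩

end AddCert

end Summit.Ventures.QEC.Census
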